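import Literature.Probability.RandomPlanarGeometry.HexSAWBrickWallStripFugacityWidthOneContactBorelLDP
import Literature.Probability.RandomPlanarGeometry.HexSAWBrickWallStripFugacityWidthOneContactRungFreeCost
import HarnessLib

/-!
# The large deviation costs of rung-poor and rung-rich walks: the two corners of the total contact density

Child module of `…ContactBorelLDP` (the LDP limit on every open convex set meeting the closed density triangle `T̄`) and `…ContactRungFreeCost`
(the infimum `log μ₁(y,z) − ½ log max(y,z)` of the extended rate `J̄_{y,z}` over the adsorbed edge `a + a' = ½`).  The TOTAL contact density
`(bc + tc)/N` ranges over `[1/3, 1/2]` on `T̄` (rung density `ρ = 1 − 2(a + a') ∈ [0, 1/3]`); its LDP in the open range is the tree's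
`tendsto_log_totalContactsRay_ge_le_div` (#RungRays).  Here the two ENDPOINTS (DOOR-ap5-g23 item 4):
* §1 `J̄` is uniformly continuous on the compact `T̄`;
* §2 ★★★ RUNG-POOR WALKS: for every `c < ½`, `lim (1/N) log P_{N,y,z}(bc + tc > cN) = −min_{T̄ ∩ {a+a' ≥ c}} J̄ =: −L(c)` (an instance of
  `ldp_limit_open_convex_closed`), and ★★★ `L(c) → log μ₁(y,z) − ½ log max(y,z)` as `c ↑ ½` — THE COST OF (NEARLY) RUNG-FREE WALKS is the
  rung-free cost of #RungFreeCost (the minimiser slides to the vertex of the more attractive wall);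
* §3 ★★★ RUNG-RICH WALKS: for every `c > 1/3`, `lim (1/N) log P_{N,y,z}(bc + tc < cN) = −min_{T̄ ∩ {a+a' ≤ c}} J̄ =: −L'(c)`, and
  ★★★ `L'(c) → log μ₁(y,z) − (log y + log z)/6` as `c ↓ 1/3` — THE COST OF A RUNG AT (NEARLY) EVERY THIRD STEP is the zigzag-vertex cost of #774
  (the set `T̄ ∩ {a + a' ≤ c}` shrinks to the vertex `(1/6,1/6)`).

## Sources
DemboZeitouni2010 §1.2 (contraction to a half-line functional; continuity sets) and §2.2 Theorem 2.2.30; JansevanRensburg2000 §3.3, §5 (1st ed.,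
OUP 2000: the density of visits / contacts of adsorbing walks and its rate function at the endpoints).  Nothing quoted AS PRINTED; statements are
this lineage's.
-/

noncomputable section

open Filter Topology Finset Literature.Probability.LatticeModels Literature.Probability.Percolation SimpleGraph

namespace Literature.Probability.RandomPlanarGeometry.SAW.HexBW

open WidthOneYZ Real

variable {y z : ℝ}

/-! ## §1 Uniform continuity of the extended rate on the closed triangle -/

/-- `J̄_{y,z}` is uniformly continuous on the compact closed triangle: for every `ε > 0` there is `δ > 0` with `|J̄ p − J̄ q| < ε` whenever
`p, q ∈ T̄` and `dist p q < δ` (sup distance). [cite: DemboZeitouni2010, §1.2 (lane plumbing)] -/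
theorem rateExt_uniform (y z : ℝ) {ε : ℝ} (hε : 0 < ε) :
    ∃ δ : ℝ, 0 < δ ∧ ∀ p ∈ {p : ℝ × ℝ | p.1 + p.2 ≤ 1 / 2 ∧ 1 ≤ 4 * p.1 + 2 * p.2 ∧ 1 ≤ 2 * p.1 + 4 * p.2},
      ∀ q ∈ {p : ℝ × ℝ | p.1 + p.2 ≤ 1 / 2 ∧ 1 ≤ 4 * p.1 + 2 * p.2 ∧ 1 ≤ 2 * p.1 + 4 * p.2}, dist p q < δ →
      |(Real.log (stripMuY₂ 1 y z) - p.1 * Real.log y - p.2 * Real.log z -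
          (negMulLog (1 - 2 * p.1 - 2 * p.2) +
            (negMulLog (4 * p.1 + 2 * p.2 - 1) + negMulLog (2 * p.1 + 4 * p.2 - 1) - negMulLog (2 * p.1) - negMulLog (2 * p.2)) / 2)) -
        (Real.log (stripMuY₂ 1 y z) - q.1 * Real.log y - q.2 * Real.log z -
          (negMulLog (1 - 2 * q.1 - 2 * q.2) +
            (negMulLog (4 * q.1 + 2 * q.2 - 1) + negMulLog (2 * q.1 + 4 * q.2 - 1) - negMulLog (2 * q.1) - negMulLog (2 * q.2)) / 2))| < ε := by
  set J : ℝ × ℝ → ℝ := fun p => Real.log (stripMuY₂ 1 y z) - p.1 * Real.log y - p.2 * Real.log z -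
      (negMulLog (1 - 2 * p.1 - 2 * p.2) +
        (negMulLog (4 * p.1 + 2 * p.2 - 1) + negMulLog (2 * p.1 + 4 * p.2 - 1) - negMulLog (2 * p.1) - negMulLog (2 * p.2)) / 2)
    with hJdef
  have hJc : Continuous J := continuous_rateExt y z
  have hu := isCompact_densityTriangle_closed.uniformContinuousOn_of_continuous hJc.continuousOn
  rw [Metric.uniformContinuousOn_iff] at hu
  obtain ⟨δ, hδ0, hδ⟩ := hu ε hε
  refine ⟨δ, hδ0, fun p hp q hq hpq => ?_⟩
  have h := hδ p hp q hq hpq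
  rw [Real.dist_eq] at h
  exact h

/-! ## §2 Rung-poor walks: the adsorbed-edge endpoint -/

open Classical in
/-- ★★★ **LDP limit for rung-poor walks**: for `y, z > 0` and every level `c < ½` there is a minimiser `m` of `J̄_{y,z}` on `T̄ ∩ {c ≤ a + a'}`... in
the form delivered by `ldp_limit_open_convex_closed` for the open half-plane `G = {c < a + a'}`: `m ∈ cl G ∩ T̄` minimises `J̄` there and
`lim (1/N) log P_{N,y,z}(c < bc/N + tc/N) = −J̄(m)`. [cite: DemboZeitouni2010, §1.2 and §2.2 Theorem 2.2.30 (lane statement); JansevanRensburg2000, §3.3, §5 (1st ed.)] -/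
theorem ldp_limit_totalContacts_gt (hy : 0 < y) (hz : 0 < z) {c : ℝ} (hc : c < 1 / 2) :
    ∃ m ∈ closure {p : ℝ × ℝ | c < p.1 + p.2} ∩ {p : ℝ × ℝ | p.1 + p.2 ≤ 1 / 2 ∧ 1 ≤ 4 * p.1 + 2 * p.2 ∧ 1 ≤ 2 * p.1 + 4 * p.2},
      IsMinOn (fun p : ℝ × ℝ => Real.log (stripMuY₂ 1 y z) - p.1 * Real.log y - p.2 * Real.log z -
        (negMulLog (1 - 2 * p.1 - 2 * p.2) +
          (negMulLog (4 * p.1 + 2 * p.2 - 1) + negMulLog (2 * p.1 + 4 * p.2 - 1) - negMulLog (2 * p.1) - negMulLog (2 * p.2)) / 2))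
        (closure {p : ℝ × ℝ | c < p.1 + p.2} ∩ {p : ℝ × ℝ | p.1 + p.2 ≤ 1 / 2 ∧ 1 ≤ 4 * p.1 + 2 * p.2 ∧ 1 ≤ 2 * p.1 + 4 * p.2}) m ∧
      Tendsto (fun N : ℕ => Real.log ((∑ q ∈ (stripPairs 1 N).filter (fun q =>
          (((bottomVisits₀ q.1 q.2 N : ℝ) / N, (topVisits₀ 1 q.1 q.2 N : ℝ) / N) : ℝ × ℝ) ∈ {p : ℝ × ℝ | c < p.1 + p.2}), wgt y z N q) /
          stripZ₂ 1 N y z) / N)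
        atTop (𝓝 (-(Real.log (stripMuY₂ 1 y z) - m.1 * Real.log y - m.2 * Real.log z -
          (negMulLog (1 - 2 * m.1 - 2 * m.2) +
            (negMulLog (4 * m.1 + 2 * m.2 - 1) + negMulLog (2 * m.1 + 4 * m.2 - 1) - negMulLog (2 * m.1) - negMulLog (2 * m.2)) / 2)))) := by
  have hGo : IsOpen {p : ℝ × ℝ | c < p.1 + p.2} := isOpen_lt continuous_const (continuous_fst.add continuous_snd)
  have hGc : Convex ℝ {p : ℝ × ℝ | c < p.1 + p.2} := by
    intro p hp q hq a b ha hb hab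
    simp only [Set.mem_setOf_eq, Prod.fst_add, Prod.snd_add, Prod.smul_fst, Prod.smul_snd, smul_eq_mul] at hp hq ⊢
    rcases ha.lt_or_eq with ha' | ha'
    · nlinarith [mul_pos ha' (sub_pos.2 hp), mul_nonneg hb (sub_pos.2 hq).le]
    · rw [← ha'] at hab ⊢; simp only [zero_add] at hab; rw [hab]; linarith
  -- the vertex `(½, 0)` lies in `G ∩ T̄`
  have hne : ({p : ℝ × ℝ | c < p.1 + p.2} ∩
      {p : ℝ × ℝ | p.1 + p.2 ≤ 1 / 2 ∧ 1 ≤ 4 * p.1 + 2 * p.2 ∧ 1 ≤ 2 * p.1 + 4 * p.2}).Nonempty :=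
    ⟨((1 / 2 : ℝ), (0 : ℝ)), by simp only [Set.mem_inter_iff, Set.mem_setOf_eq]; refine ⟨by linarith, ?_, ?_, ?_⟩ <;> norm_num⟩
  exact ldp_limit_open_convex_closed hy hz hGo hGc hne

/-- ★★★ **THE COST OF RUNG-POOR WALKS IS THE RUNG-FREE COST**: for `y, z > 0` and `ε > 0` there is `c₀ < ½` such that for every level
`c ∈ [c₀, ½)` every minimiser `m` of `J̄_{y,z}` on `cl{c < a + a'} ∩ T̄` (as in `ldp_limit_totalContacts_gt`) satisfies
`|J̄(m) − (log μ₁(y,z) − ½ log max(y,z))| ≤ ε`: so `lim_{c ↑ ½} lim_N (1/N) log P_{N,y,z}(bc + tc > cN) = −(log μ₁ − ½ log max(y,z))` — walks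
with rung density `≤ 1 − 2c ↓ 0` pay exactly the rung-free cost of #RungFreeCost, the infimum of `J̄` over the adsorbed edge (attained at the
vertex of the MORE attractive wall).  Upper bound: that vertex lies in the set; lower bound: slide `m` by `(d,d)`, `2d = ½ − (m₁+m₂) ≤ ½ − c`,
onto the edge and use uniform continuity. [cite: JansevanRensburg2000, §3.3, §5 (1st ed.; lane statement); DemboZeitouni2010, §1.2 and §2.2 Theorem 2.2.30] -/
theorem rungPoorCost_near_rungFreeCost (hy : 0 < y) (hz : 0 < z) {ε : ℝ} (hε : 0 < ε) :
    ∃ c₀ : ℝ, c₀ < 1 / 2 ∧ ∀ {c : ℝ}, c₀ ≤ c → c < 1 / 2 →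
      ∀ m ∈ closure {p : ℝ × ℝ | c < p.1 + p.2} ∩ {p : ℝ × ℝ | p.1 + p.2 ≤ 1 / 2 ∧ 1 ≤ 4 * p.1 + 2 * p.2 ∧ 1 ≤ 2 * p.1 + 4 * p.2},
        IsMinOn (fun p : ℝ × ℝ => Real.log (stripMuY₂ 1 y z) - p.1 * Real.log y - p.2 * Real.log z -
          (negMulLog (1 - 2 * p.1 - 2 * p.2) +
            (negMulLog (4 * p.1 + 2 * p.2 - 1) + negMulLog (2 * p.1 + 4 * p.2 - 1) - negMulLog (2 * p.1) - negMulLog (2 * p.2)) / 2))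
          (closure {p : ℝ × ℝ | c < p.1 + p.2} ∩ {p : ℝ × ℝ | p.1 + p.2 ≤ 1 / 2 ∧ 1 ≤ 4 * p.1 + 2 * p.2 ∧ 1 ≤ 2 * p.1 + 4 * p.2}) m →
        |(Real.log (stripMuY₂ 1 y z) - m.1 * Real.log y - m.2 * Real.log z -
          (negMulLog (1 - 2 * m.1 - 2 * m.2) +
            (negMulLog (4 * m.1 + 2 * m.2 - 1) + negMulLog (2 * m.1 + 4 * m.2 - 1) - negMulLog (2 * m.1) - negMulLog (2 * m.2)) / 2)) -
          (Real.log (stripMuY₂ 1 y z) - Real.log (max y z) / 2)| ≤ ε := by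
  set T : Set (ℝ × ℝ) := {p : ℝ × ℝ | p.1 + p.2 ≤ 1 / 2 ∧ 1 ≤ 4 * p.1 + 2 * p.2 ∧ 1 ≤ 2 * p.1 + 4 * p.2} with hT
  set J : ℝ × ℝ → ℝ := fun p => Real.log (stripMuY₂ 1 y z) - p.1 * Real.log y - p.2 * Real.log z -
      (negMulLog (1 - 2 * p.1 - 2 * p.2) +
        (negMulLog (4 * p.1 + 2 * p.2 - 1) + negMulLog (2 * p.1 + 4 * p.2 - 1) - negMulLog (2 * p.1) - negMulLog (2 * p.2)) / 2)
    with hJdef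
  obtain ⟨δ, hδ0, hδ⟩ := rateExt_uniform y z hε
  -- `c₀ = ½ − δ'` with `δ' = min δ (1/4)` so that the slide `(d,d)`, `d ≤ (½ − c)/2 < δ`, is short
  refine ⟨1 / 2 - min δ (1 / 4), by have := lt_min hδ0 (by norm_num : (0:ℝ) < 1 / 4); linarith, fun {c} hc0 hc1 m hm hmin => ?_⟩
  obtain ⟨hmcl, hmT⟩ := hm
  obtain ⟨t1, t2, t3⟩ := hmT
  -- `c ≤ m.1 + m.2` (closure of the open half-plane lies in the closed one)
  have hmc : c ≤ m.1 + m.2 := by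
    have hcl : closure {p : ℝ × ℝ | c < p.1 + p.2} ⊆ {p : ℝ × ℝ | c ≤ p.1 + p.2} :=
      closure_minimal (fun p (hp : c < p.1 + p.2) => le_of_lt hp) (isClosed_le continuous_const (continuous_fst.add continuous_snd))
    exact hcl hmcl
  -- UPPER: the vertex of the more attractive wall is in the set
  have hup : J m ≤ Real.log (stripMuY₂ 1 y z) - Real.log (max y z) / 2 := by
    rcases le_total z y with hzy | hyz
    · have hv : ((1 / 2 : ℝ), (0 : ℝ)) ∈ closure {p : ℝ × ℝ | c < p.1 + p.2} ∩ T :=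
        ⟨subset_closure (by simp only [Set.mem_setOf_eq]; linarith),
          by simp only [hT, Set.mem_setOf_eq]; refine ⟨?_, ?_, ?_⟩ <;> norm_num⟩
      have h := hmin hv
      simp only [Set.mem_setOf_eq] at h
      have e := (rateExt_edge_eq_rungFreeCost y z).1 hzy
      have ev := rateExt_vertex_half_zero y z
      change J m ≤ J ((1 / 2 : ℝ), (0 : ℝ)) at h
      have hJv : J ((1 / 2 : ℝ), (0 : ℝ)) = Real.log (stripMuY₂ 1 y z) - Real.log y / 2 := by rw [hJdef]; exact ev
      rw [hJv] at h; rw [max_eq_left hzy]; exact h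
    · have hv : ((0 : ℝ), (1 / 2 : ℝ)) ∈ closure {p : ℝ × ℝ | c < p.1 + p.2} ∩ T :=
        ⟨subset_closure (by simp only [Set.mem_setOf_eq]; linarith),
          by simp only [hT, Set.mem_setOf_eq]; refine ⟨?_, ?_, ?_⟩ <;> norm_num⟩
      have h := hmin hv
      change J m ≤ J ((0 : ℝ), (1 / 2 : ℝ)) at h
      have hJv : J ((0 : ℝ), (1 / 2 : ℝ)) = Real.log (stripMuY₂ 1 y z) - Real.log z / 2 := by
        rw [hJdef]; exact rateExt_vertex_zero_half y z
      rw [hJv] at h; rw [max_eq_right hyz]; exact h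
  -- LOWER: slide to the edge point `e = (m.1 + d, m.2 + d)`, `2d = ½ − (m.1+m.2)`
  set d := (1 / 2 - (m.1 + m.2)) / 2 with hd
  have hd0 : 0 ≤ d := by rw [hd]; linarith
  have hdδ : d < δ := by
    have : min δ (1 / 4) ≤ δ := min_le_left _ _
    rw [hd]; linarith
  set e : ℝ × ℝ := (m.1 + d, m.2 + d) with he
  have heT : e ∈ T := by
    simp only [he, hT, Set.mem_setOf_eq]; refine ⟨?_, ?_, ?_⟩ <;> linarith
  have hme : dist m e < δ := by
    rw [Prod.dist_eq, Real.dist_eq, Real.dist_eq]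
    simp only [he]
    rw [show m.1 - (m.1 + d) = -d by ring, show m.2 - (m.2 + d) = -d by ring, abs_neg, abs_of_nonneg hd0, max_self]
    exact hdδ
  have hcont := hδ m ⟨t1, t2, t3⟩ e heT hme
  change |J m - J e| < ε at hcont
  -- `J e ≥ rung-free cost` (the edge: `e.1 + e.2 = ½`)
  have he1 : 0 ≤ e.1 := by simp only [he]; linarith
  have he2 : e.1 ≤ 1 / 2 := by simp only [he]; linarith
  have hJe : J e = Real.log (stripMuY₂ 1 y z) - e.1 * Real.log y - (1 / 2 - e.1) * Real.log z := by
    have hsum : e.2 = 1 / 2 - e.1 := by simp only [he]; rw [hd]; ring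
    rw [hJdef]; simp only
    rw [hsum]
    exact rateExt_adsorbedEdge y z e.1
  have hlow : Real.log (stripMuY₂ 1 y z) - Real.log (max y z) / 2 ≤ J e := by
    rw [hJe]; exact rungFreeCost_le_rateExt_edge hy hz he1 he2
  show |J m - (Real.log (stripMuY₂ 1 y z) - Real.log (max y z) / 2)| ≤ ε
  rw [abs_le]
  constructor
  · have := (abs_lt.1 hcont).1; linarith
  · linarith

/-! ## §3 Rung-rich walks: the zigzag-vertex endpoint -/

open Classical in
/-- ★★★ **LDP limit for rung-rich walks**: for `y, z > 0` and every level `c > 1/3`, with the open half-plane `G = {a + a' < c}` (which meets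
`T̄` at the zigzag vertex): a minimiser `m ∈ cl G ∩ T̄` of `J̄_{y,z}` and `lim (1/N) log P_{N,y,z}(bc/N + tc/N < c) = −J̄(m)`.
[cite: DemboZeitouni2010, §1.2 and §2.2 Theorem 2.2.30 (lane statement); JansevanRensburg2000, §3.3, §5 (1st ed.)] -/
theorem ldp_limit_totalContacts_lt (hy : 0 < y) (hz : 0 < z) {c : ℝ} (hc : 1 / 3 < c) :
    ∃ m ∈ closure {p : ℝ × ℝ | p.1 + p.2 < c} ∩ {p : ℝ × ℝ | p.1 + p.2 ≤ 1 / 2 ∧ 1 ≤ 4 * p.1 + 2 * p.2 ∧ 1 ≤ 2 * p.1 + 4 * p.2},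
      IsMinOn (fun p : ℝ × ℝ => Real.log (stripMuY₂ 1 y z) - p.1 * Real.log y - p.2 * Real.log z -
        (negMulLog (1 - 2 * p.1 - 2 * p.2) +
          (negMulLog (4 * p.1 + 2 * p.2 - 1) + negMulLog (2 * p.1 + 4 * p.2 - 1) - negMulLog (2 * p.1) - negMulLog (2 * p.2)) / 2))
        (closure {p : ℝ × ℝ | p.1 + p.2 < c} ∩ {p : ℝ × ℝ | p.1 + p.2 ≤ 1 / 2 ∧ 1 ≤ 4 * p.1 + 2 * p.2 ∧ 1 ≤ 2 * p.1 + 4 * p.2}) m ∧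
      Tendsto (fun N : ℕ => Real.log ((∑ q ∈ (stripPairs 1 N).filter (fun q =>
          (((bottomVisits₀ q.1 q.2 N : ℝ) / N, (topVisits₀ 1 q.1 q.2 N : ℝ) / N) : ℝ × ℝ) ∈ {p : ℝ × ℝ | p.1 + p.2 < c}), wgt y z N q) /
          stripZ₂ 1 N y z) / N)
        atTop (𝓝 (-(Real.log (stripMuY₂ 1 y z) - m.1 * Real.log y - m.2 * Real.log z -
          (negMulLog (1 - 2 * m.1 - 2 * m.2) +
            (negMulLog (4 * m.1 + 2 * m.2 - 1) + negMulLog (2 * m.1 + 4 * m.2 - 1) - negMulLog (2 * m.1) - negMulLog (2 * m.2)) / 2)))) := by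
  have hGo : IsOpen {p : ℝ × ℝ | p.1 + p.2 < c} := isOpen_lt (continuous_fst.add continuous_snd) continuous_const
  have hGc : Convex ℝ {p : ℝ × ℝ | p.1 + p.2 < c} := by
    intro p hp q hq a b ha hb hab
    simp only [Set.mem_setOf_eq, Prod.fst_add, Prod.snd_add, Prod.smul_fst, Prod.smul_snd, smul_eq_mul] at hp hq ⊢
    rcases ha.lt_or_eq with ha' | ha'
    · nlinarith [mul_pos ha' (sub_pos.2 hp), mul_nonneg hb (sub_pos.2 hq).le]
    · rw [← ha'] at hab ⊢; simp only [zero_add] at hab; rw [hab]; linarith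
  have hne : ({p : ℝ × ℝ | p.1 + p.2 < c} ∩
      {p : ℝ × ℝ | p.1 + p.2 ≤ 1 / 2 ∧ 1 ≤ 4 * p.1 + 2 * p.2 ∧ 1 ≤ 2 * p.1 + 4 * p.2}).Nonempty :=
    ⟨((1 / 6 : ℝ), (1 / 6 : ℝ)), by simp only [Set.mem_inter_iff, Set.mem_setOf_eq]; refine ⟨by linarith, ?_, ?_, ?_⟩ <;> norm_num⟩
  exact ldp_limit_open_convex_closed hy hz hGo hGc hne

/-- ★★★ **THE COST OF RUNG-RICH WALKS IS THE ZIGZAG COST**: for `y, z > 0` and `ε > 0` there is `c₁ > 1/3` such that for every level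
`c ∈ (1/3, c₁]` every minimiser `m` of `J̄_{y,z}` on `cl{a + a' < c} ∩ T̄` satisfies `|J̄(m) − (log μ₁(y,z) − (log y + log z)/6)| ≤ ε`: so
`lim_{c ↓ 1/3} lim_N (1/N) log P_{N,y,z}(bc + tc < cN) = −(log μ₁ − (log y + log z)/6)` — walks with a rung at (nearly) every third step pay
the zigzag-vertex cost of #774 (`rateExt_zigzag`; positive by `zigzagCost_pos`, small in the repelling sector of #ZigzagSector).  The set
`T̄ ∩ {a + a' ≤ c}` lies in the sup-ball of radius `2(c − 1/3)` around `(1/6,1/6)`. [cite: JansevanRensburg2000, §3.3, §5 (1st ed.; lane statement); DemboZeitouni2010, §1.2 and §2.2 Theorem 2.2.30] -/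
theorem rungRichCost_near_zigzagCost (y z : ℝ) {ε : ℝ} (hε : 0 < ε) :
    ∃ c₁ : ℝ, 1 / 3 < c₁ ∧ ∀ {c : ℝ}, 1 / 3 < c → c ≤ c₁ →
      ∀ m ∈ closure {p : ℝ × ℝ | p.1 + p.2 < c} ∩ {p : ℝ × ℝ | p.1 + p.2 ≤ 1 / 2 ∧ 1 ≤ 4 * p.1 + 2 * p.2 ∧ 1 ≤ 2 * p.1 + 4 * p.2},
        IsMinOn (fun p : ℝ × ℝ => Real.log (stripMuY₂ 1 y z) - p.1 * Real.log y - p.2 * Real.log z -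
          (negMulLog (1 - 2 * p.1 - 2 * p.2) +
            (negMulLog (4 * p.1 + 2 * p.2 - 1) + negMulLog (2 * p.1 + 4 * p.2 - 1) - negMulLog (2 * p.1) - negMulLog (2 * p.2)) / 2))
          (closure {p : ℝ × ℝ | p.1 + p.2 < c} ∩ {p : ℝ × ℝ | p.1 + p.2 ≤ 1 / 2 ∧ 1 ≤ 4 * p.1 + 2 * p.2 ∧ 1 ≤ 2 * p.1 + 4 * p.2}) m →
        |(Real.log (stripMuY₂ 1 y z) - m.1 * Real.log y - m.2 * Real.log z -
          (negMulLog (1 - 2 * m.1 - 2 * m.2) +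
            (negMulLog (4 * m.1 + 2 * m.2 - 1) + negMulLog (2 * m.1 + 4 * m.2 - 1) - negMulLog (2 * m.1) - negMulLog (2 * m.2)) / 2)) -
          (Real.log (stripMuY₂ 1 y z) - (Real.log y + Real.log z) / 6)| ≤ ε := by
  set T : Set (ℝ × ℝ) := {p : ℝ × ℝ | p.1 + p.2 ≤ 1 / 2 ∧ 1 ≤ 4 * p.1 + 2 * p.2 ∧ 1 ≤ 2 * p.1 + 4 * p.2} with hT
  set J : ℝ × ℝ → ℝ := fun p => Real.log (stripMuY₂ 1 y z) - p.1 * Real.log y - p.2 * Real.log z -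
      (negMulLog (1 - 2 * p.1 - 2 * p.2) +
        (negMulLog (4 * p.1 + 2 * p.2 - 1) + negMulLog (2 * p.1 + 4 * p.2 - 1) - negMulLog (2 * p.1) - negMulLog (2 * p.2)) / 2)
    with hJdef
  obtain ⟨δ, hδ0, hδ⟩ := rateExt_uniform y z hε
  -- `c₁ = 1/3 + δ/4`: then `|m.i − 1/6| ≤ 2(c − 1/3) ≤ δ/2 < δ`
  refine ⟨1 / 3 + δ / 4, by linarith, fun {c} hc0 hc1 m hm hmin => ?_⟩
  obtain ⟨hmcl, hmT⟩ := hm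
  obtain ⟨t1, t2, t3⟩ := hmT
  have hmc : m.1 + m.2 ≤ c := by
    have hcl : closure {p : ℝ × ℝ | p.1 + p.2 < c} ⊆ {p : ℝ × ℝ | p.1 + p.2 ≤ c} :=
      closure_minimal (fun p (hp : p.1 + p.2 < c) => le_of_lt hp) (isClosed_le (continuous_fst.add continuous_snd) continuous_const)
    exact hcl hmcl
  set v : ℝ × ℝ := ((1 / 6 : ℝ), (1 / 6 : ℝ)) with hv
  have hvT : v ∈ T := by simp only [hv, hT, Set.mem_setOf_eq]; refine ⟨?_, ?_, ?_⟩ <;> norm_num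
  have hJv : J v = Real.log (stripMuY₂ 1 y z) - (Real.log y + Real.log z) / 6 := by
    rw [hJdef]; exact rateExt_zigzag y z
  -- UPPER: the vertex is in the set
  have hup : J m ≤ J v := by
    have hvG : v ∈ closure {p : ℝ × ℝ | p.1 + p.2 < c} ∩ T :=
      ⟨subset_closure (by simp only [hv, Set.mem_setOf_eq]; linarith), hvT⟩
    exact hmin hvG
  -- LOWER: `m` is close to the vertex
  have hmv : dist m v < δ := by
    rw [Prod.dist_eq, Real.dist_eq, Real.dist_eq, max_lt_iff]
    simp only [hv]
    constructor
    · rw [abs_lt]; constructor <;> linarith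
    · rw [abs_lt]; constructor <;> linarith
  have hcont := hδ m ⟨t1, t2, t3⟩ v hvT hmv
  change |J m - J v| < ε at hcont
  show |J m - (Real.log (stripMuY₂ 1 y z) - (Real.log y + Real.log z) / 6)| ≤ ε
  rw [← hJv, abs_le]
  constructor
  · have := (abs_lt.1 hcont).1; linarith
  · linarith

end Literature.Probability.RandomPlanarGeometry.SAW.HexBW
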